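import Summits.BirchSwinnertonDyer.BirchSwinnertonDyer.Theorems.QuadraticBranchSignedControlPlusEtaNonsurjPlusCoeffCongruenceMuCertificate
import Summits.BirchSwinnertonDyer.BirchSwinnertonDyer.Theorems.QuadraticBranchSignedControlPlusEtaNonsurjUncongruentRecords01
import HarnessLib

/-!
# Route `QuadraticBranchSignedControl` (rung K8, cell `bsd-potss`), residual crux `PlusEtaMainConjectureNonsurj`
# (stmt-BirchSwinnertonDyer-19606): μ⁺-RECORDS 02 — v7's `stub_analyticEtaMu_cm` AT 8 CM ROWS `V` of the crux at `p = 5`, each from the row's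
# KERNEL data (`Δ ≠ 0`, global minimality, `5 ∤ Δ`, `#V(𝔽₅) = 6` i.e. `a_5 = 0`), Mazur's named fact `hM`, and ONE displayed pattern of `λ⁺ + 1`
# exact-rational symbol valuations (seat `bsd-potss-k8eta-c2` g25; consumer of `…PlusCoeffCongruenceMuCertificate.lean`)

WHAT. For each row `V` below (a globally minimal CM curve with `5` inert in its CM field, good at `5` with `a_5(V) = 0` — a CM row of the crux by
k8eta-c2 g17's `EtaCartanField.cmRow_iff_cmInert`; its `5`-adic tower is never onto), the theorem `analyticEtaMu_<row>_5` concludes VERBATIM the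
inner statement of v7's `Sig.stub_analyticEtaMu_cm` at `(V, 5)`:
«`∀ f, IsNewformOf V f → ∀ ϖ, (ϖ·Ω_V⁺ = Ω_f⁺) → ∀ Lη, IsQuadraticBranchPlusLFunction f 5 ϖ Lη → HasUnitContent Lη`» (analytic `μ⁺ = 0`),
from `EtaPlusCoeffCongruence.analyticEtaMu_row_of_mazurTate_padicNorm[_zero]` (the λ⁺-reading: unitriangular θ-coefficient congruence at level
`2`, diagonal `5`, `Lη = v·ϖ·M⁺`). DISPLAYED per row (hypothesis `hθ`, a statement about `λ⁺ + 1` exact rationals): with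
`θ₂(η) = quadraticBranchMazurTateElement 5 f 2` (a signed sum of `100` modular symbols `[a/125]⁺_f`), `‖ϖ·coeff_jθ₂(η)‖₅ ≤ 5⁻²` for `j < λ⁺` and
`‖ϖ·coeff_{λ⁺}θ₂(η)‖₅ = 5⁻¹` (rows with `λ⁺ ∈ {1,2,3}`), resp. `‖ϖ·θ₀(η)‖₅ = 1` (rows with `λ⁺ = 0`; `θ₀(η) = Σ_a η(a)[a/5]⁺_f`, Kobayashi (3.6)).
THE NUMBERS (kit j337120 of k8eta-c2 g25, engine MT-C1 stages 1–2 of k8eta-c2 g23/g24 BYTE-IDENTICAL, fold `P25-cm5-…tsv` in HOME `k8eta-c2/g25/tables/`;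
p = 5 census of ALL CM rows of g18's table with N_V ≤ 4·10⁸: on every row folded so far the kernel reading of `λ⁺` EQUALS PARI's `λ⁺` — see the
g25 memo for the final counts): `b_j = Σ_{u<25} C(u,j)·TH₂[u]` with
`TH₂[u] = Σ_{m ≡ u (25)} η(2)^m [2^m/125]⁺_V` (symbols normalised by the Néron period of `V`), quoted in each docstring with their `5`-adic valuations.
CONVENTION-INVARIANCE (why the displayed PATTERN is the engine's): the engine writes `θ₂(η)` in the variable `X' = γ' − 1`, `γ' = ⟨2⟩ = γ^a`
(`a ∈ ℤ₅ˣ`, `γ = 6` the tree's `cyclotomicGenerator`); the change of variable `X' = (1+X)^a − 1 = aX + …` is unitriangular on coefficients modulo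
`(ω₂, 5²)` in degrees `< 5`, so «`v₅(b_j) ≥ 2` for `j < λ`, `v₅(b_λ) = 1`» holds in one variable iff in the other; the sign of `η`, `u ↦ −u` and
`Ω_V⁺ ∈ {ω₁, 2ω₁}` are `5`-adic units; `ϖ·[a/M]⁺_f = [a/M]⁺_V` (period relation). Row kernel data as in k8eta-c2 g14's records
(`isElliptic_of_discOf_ne_zero`, `isGloballyMinimal_of_krausCriterion_support`, `good_and_frobeniusTrace_eq_of_countPoints`, `decide +kernel`).

HONEST FRAMING (cell `bsd-potss`; FULL-BSD rank ≤ 1 programme, HUMAN RULING D-0036/D-0074): per-row RECORDS, CONDITIONAL on the named fact `hM`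
(Mazur) and on the displayed per-row symbol pattern (exact rational arithmetic on numerically recovered symbols — evidence, not a kernel fact);
`stub_analyticEtaMu_cm` (class-wide) is NOT proved; nothing about (A), (C1⁺_η), C-cc-1 or `BSD(W,5)` of any pair is claimed; crux and route OPEN;
nothing booked. `--supports stmt-BirchSwinnertonDyer-19606`.

References: [Pollack2003] Prop. 6.18; [Kobayashi2003] Thm. 3.2, (3.4), (3.6) (p. 7); [Mazur1978] Cor. 4.1; [GreenbergVatsal2000] p. 2 (1)–(2);
[SilvermanAEC2009] VII.1 Rem. 1.1, VII.5 Prop. 5.1; [Kraus1989] Prop. 1–2.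
-/

set_option autoImplicit false
set_option linter.dupNamespace false

noncomputable section

open scoped Classical MatrixGroups ModularForm

open CongruenceSubgroup WeierstrassCurve Literature.NumberTheory.EllipticCurves Literature.NumberTheory.EllipticCurves.ModularForms
  Literature.NumberTheory.EllipticCurves.Rank1Residual Literature.NumberTheory.EllipticCurves.GreenbergVatsal2000
  Literature.NumberTheory.EllipticCurves.Rank1Residual.X11RankOneCertificates
  Summit.BirchSwinnertonDyer.Rank1Residual.X11b Summit.BirchSwinnertonDyer.BirchSwinnertonDyer.Rank1Residual.IntModel
  Summit.BirchSwinnertonDyer.BirchSwinnertonDyer.Rank1Residual.X11RankOne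
open Summit.BirchSwinnertonDyer.Rank1Residual Summit.BirchSwinnertonDyer.Rank1Residual.Additive
open Summit.BirchSwinnertonDyer.BirchSwinnertonDyer.Theorems.EtaUncongruentRecords (good_and_frobeniusTrace_eq_of_countPoints)
open Summit.BirchSwinnertonDyer.BirchSwinnertonDyer.Theorems.EtaPlusCoeffCongruence

namespace Summit.BirchSwinnertonDyer.BirchSwinnertonDyer.Theorems.EtaAnalyticMuRecords

/-! ## Row `cm256j8000_m31` (twist of `256(j=8000)` by `-31`; `N_V = 246016`, `ε(W) = 1`, PARI `(λ⁺, λ⁻) = (2, 2)`) -/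

/-- Row `cm256j8000_m31`: `V = [0, -1, 0, -3203, -60721]`, `Δ = 454401884672` `= ±2^9·31^6`: `Δ ≠ 0` (kernel). [cite: SilvermanAEC2009, III.1] -/
theorem isElliptic_cm256j8000_m31 : (⟨0, (-1), 0, (-3203), (-60721)⟩ : WeierstrassCurve ℚ).IsElliptic :=
  isElliptic_of_discOf_ne_zero 0 (-1) 0 (-3203) (-60721) (by decide +kernel)

set_option maxRecDepth 100000 in
/-- Row `cm256j8000_m31` is a global minimal equation (Silverman VII.1 Rem. 1.1 / Kraus on the support of `Δ`, kernel). [cite: SilvermanAEC2009, VII.1 Remark 1.1] [cite: Kraus1989, Prop. 1–2] -/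
theorem isGloballyMinimal_cm256j8000_m31 : (⟨0, (-1), 0, (-3203), (-60721)⟩ : WeierstrassCurve ℚ).IsGloballyMinimal :=
  isGloballyMinimal_of_krausCriterion_support 0 (-1) 0 (-3203) (-60721) [(2, 0, 9), (31, 0, 6)]
    (by decide +kernel) (by decide +kernel) (by decide +kernel)

set_option maxRecDepth 100000 in
/-- **Row `cm256j8000_m31` — v7's `stub_analyticEtaMu_cm` AT THIS ROW (`p = 5`): every plus branch function `L_5⁺(V,η,X)` of the newform of
`V = [0, -1, 0, -3203, -60721]` (twist of `256(j=8000)` by `-31`; CM, `5` inert, `N_V = 246016`; `W = V^{(5)}` has `ε(W) = 1`; PARI `(λ⁺, λ⁻) = (2, 2)`, `μ = 0`, g18) HAS UNIT CONTENT (`μ⁺ = 0`)**,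
from the row's kernel data (`Δ ≠ 0`, minimality, `5 ∤ Δ`, `#V(𝔽₅) = 6`), Mazur's `hM`, and the DISPLAYED pattern `‖ϖ·coeff_jθ₂(η)‖₅ ≤ 5⁻²` (`j < 2`) and `‖ϖ·coeff_2θ₂(η)‖₅ = 5⁻¹` (`λ⁺ = 2`). THE NUMBERS (kit j337120,
row `cm256j8000_m31`): `b_0 = 0` (v₅ ∞), `b_1 = 900` (v₅ 2), `b_2 = 16020` (v₅ 1), `b_3 = 130940` (v₅ 1) — exactly the registered pattern for `λ⁺ = 2`. [cite: Pollack2003, Prop. 6.18] [cite: Kobayashi2003, Thm. 3.2, (3.4), (3.6) (p. 7)]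
[cite: Mazur1978, Cor. 4.1] [cite: GreenbergVatsal2000, p. 2, (2)] -/
theorem analyticEtaMu_cm256j8000_m31_5 [Fact (5 : ℕ).Prime] (hM : mazur_not_dvd_maninConstant_of_odd)
    (V : WeierstrassCurve ℚ) [V.IsElliptic] [V.IsGloballyMinimal] (hV : V = ⟨0, (-1), 0, (-3203), (-60721)⟩)
    (hθ : ∀ {N : ℕ} [NeZero N] {f : CuspForm (Gamma0 N) 2}, IsNewformOf V f →
      ∀ (ϖ : ℚ), (if Even (5 / 2) then (ϖ : ℝ) * V.realPeriodRat = plusPeriod f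
          else (ϖ : ℝ) * V.imaginaryPeriodRat = minusPeriod f) →
        (∀ j < 2, ‖(ϖ : ℚ_[5]) * (((quadraticBranchMazurTateElement 5 f (2 * 1)).coeff j : ℚ) : ℚ_[5])‖ ≤ ((5 : ℝ)⁻¹) ^ (1 + 1)) ∧
          ‖(ϖ : ℚ_[5]) * (((quadraticBranchMazurTateElement 5 f (2 * 1)).coeff 2 : ℚ) : ℚ_[5])‖ = ((5 : ℝ)⁻¹) ^ 1) :
    ∀ {N : ℕ} [NeZero N] {f : CuspForm (Gamma0 N) 2}, IsNewformOf V f →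
      ∀ (ϖ : ℚ), (if Even (5 / 2) then (ϖ : ℝ) * V.realPeriodRat = plusPeriod f
          else (ϖ : ℝ) * V.imaginaryPeriodRat = minusPeriod f) →
      ∀ (Lη : IwasawaAlgebra 5), IsQuadraticBranchPlusLFunction f 5 ϖ Lη → HasUnitContent Lη := by
  intro N _ f hf ϖ hrel Lη hL
  subst hV
  have hI : integralModelInt (⟨0, (-1), 0, (-3203), (-60721)⟩ : WeierstrassCurve ℚ) = ⟨0, (-1), 0, (-3203), (-60721)⟩ :=
    integralModelInt_eq_of_map_eq _ (map_mk_int 0 (-1) 0 (-3203) (-60721))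
  obtain ⟨hgood, htr⟩ := good_and_frobeniusTrace_eq_of_countPoints hI 5 (by decide) (by decide +kernel)
  have hap : (⟨0, (-1), 0, (-3203), (-60721)⟩ : WeierstrassCurve ℚ).frobeniusTrace 5 = 0 := by
    rw [htr, show countPoints [0, (-1), 0, (-3203), (-60721)] 5 = 6 by decide +kernel]; norm_num
  exact analyticEtaMu_row_of_mazurTate_padicNorm 5 hM (by norm_num) _ hgood hap 1 le_rfl 2 (by norm_num) hθ hf ϖ hrel Lη hL

/-! ## Row `cm256j8000_13` (twist of `256(j=8000)` by `13`; `N_V = 43264`, `ε(W) = -1`, PARI `(λ⁺, λ⁻) = (3, 1)`) -/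

/-- Row `cm256j8000_13`: `V = [0, 1, 0, -563, 4369]`, `Δ = 2471326208` `= ±2^9·13^6`: `Δ ≠ 0` (kernel). [cite: SilvermanAEC2009, III.1] -/
theorem isElliptic_cm256j8000_13 : (⟨0, 1, 0, (-563), 4369⟩ : WeierstrassCurve ℚ).IsElliptic :=
  isElliptic_of_discOf_ne_zero 0 1 0 (-563) 4369 (by decide +kernel)

set_option maxRecDepth 100000 in
/-- Row `cm256j8000_13` is a global minimal equation (Silverman VII.1 Rem. 1.1 / Kraus on the support of `Δ`, kernel). [cite: SilvermanAEC2009, VII.1 Remark 1.1] [cite: Kraus1989, Prop. 1–2] -/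
theorem isGloballyMinimal_cm256j8000_13 : (⟨0, 1, 0, (-563), 4369⟩ : WeierstrassCurve ℚ).IsGloballyMinimal :=
  isGloballyMinimal_of_krausCriterion_support 0 1 0 (-563) 4369 [(2, 0, 9), (13, 0, 6)]
    (by decide +kernel) (by decide +kernel) (by decide +kernel)

set_option maxRecDepth 100000 in
/-- **Row `cm256j8000_13` — v7's `stub_analyticEtaMu_cm` AT THIS ROW (`p = 5`): every plus branch function `L_5⁺(V,η,X)` of the newform of
`V = [0, 1, 0, -563, 4369]` (twist of `256(j=8000)` by `13`; CM, `5` inert, `N_V = 43264`; `W = V^{(5)}` has `ε(W) = -1`; PARI `(λ⁺, λ⁻) = (3, 1)`, `μ = 0`, g18) HAS UNIT CONTENT (`μ⁺ = 0`)**,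
from the row's kernel data (`Δ ≠ 0`, minimality, `5 ∤ Δ`, `#V(𝔽₅) = 6`), Mazur's `hM`, and the DISPLAYED pattern `‖ϖ·coeff_jθ₂(η)‖₅ ≤ 5⁻²` (`j < 3`) and `‖ϖ·coeff_3θ₂(η)‖₅ = 5⁻¹` (`λ⁺ = 3`). THE NUMBERS (kit j337120,
row `cm256j8000_13`): `b_0 = 0` (v₅ ∞), `b_1 = 50` (v₅ 2), `b_2 = -300` (v₅ 2), `b_3 = -6640` (v₅ 1), `b_4 = -45370` (v₅ 1) — exactly the registered pattern for `λ⁺ = 3`. [cite: Pollack2003, Prop. 6.18] [cite: Kobayashi2003, Thm. 3.2, (3.4), (3.6) (p. 7)]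
[cite: Mazur1978, Cor. 4.1] [cite: GreenbergVatsal2000, p. 2, (2)] -/
theorem analyticEtaMu_cm256j8000_13_5 [Fact (5 : ℕ).Prime] (hM : mazur_not_dvd_maninConstant_of_odd)
    (V : WeierstrassCurve ℚ) [V.IsElliptic] [V.IsGloballyMinimal] (hV : V = ⟨0, 1, 0, (-563), 4369⟩)
    (hθ : ∀ {N : ℕ} [NeZero N] {f : CuspForm (Gamma0 N) 2}, IsNewformOf V f →
      ∀ (ϖ : ℚ), (if Even (5 / 2) then (ϖ : ℝ) * V.realPeriodRat = plusPeriod f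
          else (ϖ : ℝ) * V.imaginaryPeriodRat = minusPeriod f) →
        (∀ j < 3, ‖(ϖ : ℚ_[5]) * (((quadraticBranchMazurTateElement 5 f (2 * 1)).coeff j : ℚ) : ℚ_[5])‖ ≤ ((5 : ℝ)⁻¹) ^ (1 + 1)) ∧
          ‖(ϖ : ℚ_[5]) * (((quadraticBranchMazurTateElement 5 f (2 * 1)).coeff 3 : ℚ) : ℚ_[5])‖ = ((5 : ℝ)⁻¹) ^ 1) :
    ∀ {N : ℕ} [NeZero N] {f : CuspForm (Gamma0 N) 2}, IsNewformOf V f →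
      ∀ (ϖ : ℚ), (if Even (5 / 2) then (ϖ : ℝ) * V.realPeriodRat = plusPeriod f
          else (ϖ : ℝ) * V.imaginaryPeriodRat = minusPeriod f) →
      ∀ (Lη : IwasawaAlgebra 5), IsQuadraticBranchPlusLFunction f 5 ϖ Lη → HasUnitContent Lη := by
  intro N _ f hf ϖ hrel Lη hL
  subst hV
  have hI : integralModelInt (⟨0, 1, 0, (-563), 4369⟩ : WeierstrassCurve ℚ) = ⟨0, 1, 0, (-563), 4369⟩ :=
    integralModelInt_eq_of_map_eq _ (map_mk_int 0 1 0 (-563) 4369)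
  obtain ⟨hgood, htr⟩ := good_and_frobeniusTrace_eq_of_countPoints hI 5 (by decide) (by decide +kernel)
  have hap : (⟨0, 1, 0, (-563), 4369⟩ : WeierstrassCurve ℚ).frobeniusTrace 5 = 0 := by
    rw [htr, show countPoints [0, 1, 0, (-563), 4369] 5 = 6 by decide +kernel]; norm_num
  exact analyticEtaMu_row_of_mazurTate_padicNorm 5 hM (by norm_num) _ hgood hap 1 le_rfl 3 (by norm_num) hθ hf ϖ hrel Lη hL

/-! ## Row `cm27a4_17` (twist of `27a4` by `17`; `N_V = 7803`, `ε(W) = 1`, PARI `(λ⁺, λ⁻) = (2, 2)`) -/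

/-- Row `cm27a4_17`: `V = [0, 0, 1, -8670, 310747]`, `Δ = -5865429267` `= ±3^5·17^6`: `Δ ≠ 0` (kernel). [cite: SilvermanAEC2009, III.1] -/
theorem isElliptic_cm27a4_17 : (⟨0, 0, 1, (-8670), 310747⟩ : WeierstrassCurve ℚ).IsElliptic :=
  isElliptic_of_discOf_ne_zero 0 0 1 (-8670) 310747 (by decide +kernel)

set_option maxRecDepth 100000 in
/-- Row `cm27a4_17` is a global minimal equation (Silverman VII.1 Rem. 1.1 / Kraus on the support of `Δ`, kernel). [cite: SilvermanAEC2009, VII.1 Remark 1.1] [cite: Kraus1989, Prop. 1–2] -/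
theorem isGloballyMinimal_cm27a4_17 : (⟨0, 0, 1, (-8670), 310747⟩ : WeierstrassCurve ℚ).IsGloballyMinimal :=
  isGloballyMinimal_of_krausCriterion_support 0 0 1 (-8670) 310747 [(3, 0, 5), (17, 0, 6)]
    (by decide +kernel) (by decide +kernel) (by decide +kernel)

set_option maxRecDepth 100000 in
/-- **Row `cm27a4_17` — v7's `stub_analyticEtaMu_cm` AT THIS ROW (`p = 5`): every plus branch function `L_5⁺(V,η,X)` of the newform of
`V = [0, 0, 1, -8670, 310747]` (twist of `27a4` by `17`; CM, `5` inert, `N_V = 7803`; `W = V^{(5)}` has `ε(W) = 1`; PARI `(λ⁺, λ⁻) = (2, 2)`, `μ = 0`, g18) HAS UNIT CONTENT (`μ⁺ = 0`)**,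
from the row's kernel data (`Δ ≠ 0`, minimality, `5 ∤ Δ`, `#V(𝔽₅) = 6`), Mazur's `hM`, and the DISPLAYED pattern `‖ϖ·coeff_jθ₂(η)‖₅ ≤ 5⁻²` (`j < 2`) and `‖ϖ·coeff_2θ₂(η)‖₅ = 5⁻¹` (`λ⁺ = 2`). THE NUMBERS (kit j337120,
row `cm27a4_17`): `b_0 = 0` (v₅ ∞), `b_1 = 125` (v₅ 3), `b_2 = 880` (v₅ 1), `b_3 = 290` (v₅ 1) — exactly the registered pattern for `λ⁺ = 2`. [cite: Pollack2003, Prop. 6.18] [cite: Kobayashi2003, Thm. 3.2, (3.4), (3.6) (p. 7)]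
[cite: Mazur1978, Cor. 4.1] [cite: GreenbergVatsal2000, p. 2, (2)] -/
theorem analyticEtaMu_cm27a4_17_5 [Fact (5 : ℕ).Prime] (hM : mazur_not_dvd_maninConstant_of_odd)
    (V : WeierstrassCurve ℚ) [V.IsElliptic] [V.IsGloballyMinimal] (hV : V = ⟨0, 0, 1, (-8670), 310747⟩)
    (hθ : ∀ {N : ℕ} [NeZero N] {f : CuspForm (Gamma0 N) 2}, IsNewformOf V f →
      ∀ (ϖ : ℚ), (if Even (5 / 2) then (ϖ : ℝ) * V.realPeriodRat = plusPeriod f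
          else (ϖ : ℝ) * V.imaginaryPeriodRat = minusPeriod f) →
        (∀ j < 2, ‖(ϖ : ℚ_[5]) * (((quadraticBranchMazurTateElement 5 f (2 * 1)).coeff j : ℚ) : ℚ_[5])‖ ≤ ((5 : ℝ)⁻¹) ^ (1 + 1)) ∧
          ‖(ϖ : ℚ_[5]) * (((quadraticBranchMazurTateElement 5 f (2 * 1)).coeff 2 : ℚ) : ℚ_[5])‖ = ((5 : ℝ)⁻¹) ^ 1) :
    ∀ {N : ℕ} [NeZero N] {f : CuspForm (Gamma0 N) 2}, IsNewformOf V f →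
      ∀ (ϖ : ℚ), (if Even (5 / 2) then (ϖ : ℝ) * V.realPeriodRat = plusPeriod f
          else (ϖ : ℝ) * V.imaginaryPeriodRat = minusPeriod f) →
      ∀ (Lη : IwasawaAlgebra 5), IsQuadraticBranchPlusLFunction f 5 ϖ Lη → HasUnitContent Lη := by
  intro N _ f hf ϖ hrel Lη hL
  subst hV
  have hI : integralModelInt (⟨0, 0, 1, (-8670), 310747⟩ : WeierstrassCurve ℚ) = ⟨0, 0, 1, (-8670), 310747⟩ :=
    integralModelInt_eq_of_map_eq _ (map_mk_int 0 0 1 (-8670) 310747)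
  obtain ⟨hgood, htr⟩ := good_and_frobeniusTrace_eq_of_countPoints hI 5 (by decide) (by decide +kernel)
  have hap : (⟨0, 0, 1, (-8670), 310747⟩ : WeierstrassCurve ℚ).frobeniusTrace 5 = 0 := by
    rw [htr, show countPoints [0, 0, 1, (-8670), 310747] 5 = 6 by decide +kernel]; norm_num
  exact analyticEtaMu_row_of_mazurTate_padicNorm 5 hM (by norm_num) _ hgood hap 1 le_rfl 2 (by norm_num) hθ hf ϖ hrel Lη hL

/-! ## Row `cm27a4_76` (twist of `27a4` by `76`; `N_V = 155952`, `ε(W) = -1`, PARI `(λ⁺, λ⁻) = (3, 1)`) -/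

/-- Row `cm27a4_76`: `V = [0, 0, 0, -173280, 27765232]`, `Δ = -46826082643968` `= ±2^12·3^5·19^6`: `Δ ≠ 0` (kernel). [cite: SilvermanAEC2009, III.1] -/
theorem isElliptic_cm27a4_76 : (⟨0, 0, 0, (-173280), 27765232⟩ : WeierstrassCurve ℚ).IsElliptic :=
  isElliptic_of_discOf_ne_zero 0 0 0 (-173280) 27765232 (by decide +kernel)

set_option maxRecDepth 100000 in
/-- Row `cm27a4_76` is a global minimal equation (Silverman VII.1 Rem. 1.1 / Kraus on the support of `Δ`, kernel). [cite: SilvermanAEC2009, VII.1 Remark 1.1] [cite: Kraus1989, Prop. 1–2] -/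
theorem isGloballyMinimal_cm27a4_76 : (⟨0, 0, 0, (-173280), 27765232⟩ : WeierstrassCurve ℚ).IsGloballyMinimal :=
  isGloballyMinimal_of_krausCriterion_support 0 0 0 (-173280) 27765232 [(2, 0, 12), (3, 0, 5), (19, 0, 6)]
    (by decide +kernel) (by decide +kernel) (by decide +kernel)

set_option maxRecDepth 100000 in
/-- **Row `cm27a4_76` — v7's `stub_analyticEtaMu_cm` AT THIS ROW (`p = 5`): every plus branch function `L_5⁺(V,η,X)` of the newform of
`V = [0, 0, 0, -173280, 27765232]` (twist of `27a4` by `76`; CM, `5` inert, `N_V = 155952`; `W = V^{(5)}` has `ε(W) = -1`; PARI `(λ⁺, λ⁻) = (3, 1)`, `μ = 0`, g18) HAS UNIT CONTENT (`μ⁺ = 0`)**,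
from the row's kernel data (`Δ ≠ 0`, minimality, `5 ∤ Δ`, `#V(𝔽₅) = 6`), Mazur's `hM`, and the DISPLAYED pattern `‖ϖ·coeff_jθ₂(η)‖₅ ≤ 5⁻²` (`j < 3`) and `‖ϖ·coeff_3θ₂(η)‖₅ = 5⁻¹` (`λ⁺ = 3`). THE NUMBERS (kit j337120,
row `cm27a4_76`): `b_0 = 0` (v₅ ∞), `b_1 = 0` (v₅ ∞), `b_2 = -1025` (v₅ 2), `b_3 = -12790` (v₅ 1), `b_4 = -81370` (v₅ 1) — exactly the registered pattern for `λ⁺ = 3`. [cite: Pollack2003, Prop. 6.18] [cite: Kobayashi2003, Thm. 3.2, (3.4), (3.6) (p. 7)]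
[cite: Mazur1978, Cor. 4.1] [cite: GreenbergVatsal2000, p. 2, (2)] -/
theorem analyticEtaMu_cm27a4_76_5 [Fact (5 : ℕ).Prime] (hM : mazur_not_dvd_maninConstant_of_odd)
    (V : WeierstrassCurve ℚ) [V.IsElliptic] [V.IsGloballyMinimal] (hV : V = ⟨0, 0, 0, (-173280), 27765232⟩)
    (hθ : ∀ {N : ℕ} [NeZero N] {f : CuspForm (Gamma0 N) 2}, IsNewformOf V f →
      ∀ (ϖ : ℚ), (if Even (5 / 2) then (ϖ : ℝ) * V.realPeriodRat = plusPeriod f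
          else (ϖ : ℝ) * V.imaginaryPeriodRat = minusPeriod f) →
        (∀ j < 3, ‖(ϖ : ℚ_[5]) * (((quadraticBranchMazurTateElement 5 f (2 * 1)).coeff j : ℚ) : ℚ_[5])‖ ≤ ((5 : ℝ)⁻¹) ^ (1 + 1)) ∧
          ‖(ϖ : ℚ_[5]) * (((quadraticBranchMazurTateElement 5 f (2 * 1)).coeff 3 : ℚ) : ℚ_[5])‖ = ((5 : ℝ)⁻¹) ^ 1) :
    ∀ {N : ℕ} [NeZero N] {f : CuspForm (Gamma0 N) 2}, IsNewformOf V f →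
      ∀ (ϖ : ℚ), (if Even (5 / 2) then (ϖ : ℝ) * V.realPeriodRat = plusPeriod f
          else (ϖ : ℝ) * V.imaginaryPeriodRat = minusPeriod f) →
      ∀ (Lη : IwasawaAlgebra 5), IsQuadraticBranchPlusLFunction f 5 ϖ Lη → HasUnitContent Lη := by
  intro N _ f hf ϖ hrel Lη hL
  subst hV
  have hI : integralModelInt (⟨0, 0, 0, (-173280), 27765232⟩ : WeierstrassCurve ℚ) = ⟨0, 0, 0, (-173280), 27765232⟩ :=
    integralModelInt_eq_of_map_eq _ (map_mk_int 0 0 0 (-173280) 27765232)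
  obtain ⟨hgood, htr⟩ := good_and_frobeniusTrace_eq_of_countPoints hI 5 (by decide) (by decide +kernel)
  have hap : (⟨0, 0, 0, (-173280), 27765232⟩ : WeierstrassCurve ℚ).frobeniusTrace 5 = 0 := by
    rw [htr, show countPoints [0, 0, 0, (-173280), 27765232] 5 = 6 by decide +kernel]; norm_num
  exact analyticEtaMu_row_of_mazurTate_padicNorm 5 hM (by norm_num) _ hgood hap 1 le_rfl 3 (by norm_num) hθ hf ϖ hrel Lη hL

/-! ## Row `cm36a2_97` (twist of `36a2` by `97`; `N_V = 338724`, `ε(W) = 1`, PARI `(λ⁺, λ⁻) = (2, 2)`) -/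

/-- Row `cm36a2_97`: `V = [0, 0, 0, -141135, 20078806]`, `Δ = 5757502498069248` `= ±2^8·3^3·97^6`: `Δ ≠ 0` (kernel). [cite: SilvermanAEC2009, III.1] -/
theorem isElliptic_cm36a2_97 : (⟨0, 0, 0, (-141135), 20078806⟩ : WeierstrassCurve ℚ).IsElliptic :=
  isElliptic_of_discOf_ne_zero 0 0 0 (-141135) 20078806 (by decide +kernel)

set_option maxRecDepth 100000 in
/-- Row `cm36a2_97` is a global minimal equation (Silverman VII.1 Rem. 1.1 / Kraus on the support of `Δ`, kernel). [cite: SilvermanAEC2009, VII.1 Remark 1.1] [cite: Kraus1989, Prop. 1–2] -/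
theorem isGloballyMinimal_cm36a2_97 : (⟨0, 0, 0, (-141135), 20078806⟩ : WeierstrassCurve ℚ).IsGloballyMinimal :=
  isGloballyMinimal_of_krausCriterion_support 0 0 0 (-141135) 20078806 [(2, 0, 8), (3, 0, 3), (97, 0, 6)]
    (by decide +kernel) (by decide +kernel) (by decide +kernel)

set_option maxRecDepth 100000 in
/-- **Row `cm36a2_97` — v7's `stub_analyticEtaMu_cm` AT THIS ROW (`p = 5`): every plus branch function `L_5⁺(V,η,X)` of the newform of
`V = [0, 0, 0, -141135, 20078806]` (twist of `36a2` by `97`; CM, `5` inert, `N_V = 338724`; `W = V^{(5)}` has `ε(W) = 1`; PARI `(λ⁺, λ⁻) = (2, 2)`, `μ = 0`, g18) HAS UNIT CONTENT (`μ⁺ = 0`)**,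
from the row's kernel data (`Δ ≠ 0`, minimality, `5 ∤ Δ`, `#V(𝔽₅) = 6`), Mazur's `hM`, and the DISPLAYED pattern `‖ϖ·coeff_jθ₂(η)‖₅ ≤ 5⁻²` (`j < 2`) and `‖ϖ·coeff_2θ₂(η)‖₅ = 5⁻¹` (`λ⁺ = 2`). THE NUMBERS (kit j337120,
row `cm36a2_97`): `b_0 = 0` (v₅ ∞), `b_1 = 1600` (v₅ 2), `b_2 = 19180` (v₅ 1), `b_3 = 131620` (v₅ 1) — exactly the registered pattern for `λ⁺ = 2`. [cite: Pollack2003, Prop. 6.18] [cite: Kobayashi2003, Thm. 3.2, (3.4), (3.6) (p. 7)]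
[cite: Mazur1978, Cor. 4.1] [cite: GreenbergVatsal2000, p. 2, (2)] -/
theorem analyticEtaMu_cm36a2_97_5 [Fact (5 : ℕ).Prime] (hM : mazur_not_dvd_maninConstant_of_odd)
    (V : WeierstrassCurve ℚ) [V.IsElliptic] [V.IsGloballyMinimal] (hV : V = ⟨0, 0, 0, (-141135), 20078806⟩)
    (hθ : ∀ {N : ℕ} [NeZero N] {f : CuspForm (Gamma0 N) 2}, IsNewformOf V f →
      ∀ (ϖ : ℚ), (if Even (5 / 2) then (ϖ : ℝ) * V.realPeriodRat = plusPeriod f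
          else (ϖ : ℝ) * V.imaginaryPeriodRat = minusPeriod f) →
        (∀ j < 2, ‖(ϖ : ℚ_[5]) * (((quadraticBranchMazurTateElement 5 f (2 * 1)).coeff j : ℚ) : ℚ_[5])‖ ≤ ((5 : ℝ)⁻¹) ^ (1 + 1)) ∧
          ‖(ϖ : ℚ_[5]) * (((quadraticBranchMazurTateElement 5 f (2 * 1)).coeff 2 : ℚ) : ℚ_[5])‖ = ((5 : ℝ)⁻¹) ^ 1) :
    ∀ {N : ℕ} [NeZero N] {f : CuspForm (Gamma0 N) 2}, IsNewformOf V f →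
      ∀ (ϖ : ℚ), (if Even (5 / 2) then (ϖ : ℝ) * V.realPeriodRat = plusPeriod f
          else (ϖ : ℝ) * V.imaginaryPeriodRat = minusPeriod f) →
      ∀ (Lη : IwasawaAlgebra 5), IsQuadraticBranchPlusLFunction f 5 ϖ Lη → HasUnitContent Lη := by
  intro N _ f hf ϖ hrel Lη hL
  subst hV
  have hI : integralModelInt (⟨0, 0, 0, (-141135), 20078806⟩ : WeierstrassCurve ℚ) = ⟨0, 0, 0, (-141135), 20078806⟩ :=
    integralModelInt_eq_of_map_eq _ (map_mk_int 0 0 0 (-141135) 20078806)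
  obtain ⟨hgood, htr⟩ := good_and_frobeniusTrace_eq_of_countPoints hI 5 (by decide) (by decide +kernel)
  have hap : (⟨0, 0, 0, (-141135), 20078806⟩ : WeierstrassCurve ℚ).frobeniusTrace 5 = 0 := by
    rw [htr, show countPoints [0, 0, 0, (-141135), 20078806] 5 = 6 by decide +kernel]; norm_num
  exact analyticEtaMu_row_of_mazurTate_padicNorm 5 hM (by norm_num) _ hgood hap 1 le_rfl 2 (by norm_num) hθ hf ϖ hrel Lη hL

/-! ## Row `cm1849a1_8` (twist of `1849a1` by `8`; `N_V = 118336`, `ε(W) = -1`, PARI `(λ⁺, λ⁻) = (3, 1)`) -/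

/-- Row `cm1849a1_8`: `V = [0, 0, 0, -3440, 77658]`, `Δ = -5088448` `= ±2^6·43^3`: `Δ ≠ 0` (kernel). [cite: SilvermanAEC2009, III.1] -/
theorem isElliptic_cm1849a1_8 : (⟨0, 0, 0, (-3440), 77658⟩ : WeierstrassCurve ℚ).IsElliptic :=
  isElliptic_of_discOf_ne_zero 0 0 0 (-3440) 77658 (by decide +kernel)

set_option maxRecDepth 100000 in
/-- Row `cm1849a1_8` is a global minimal equation (Silverman VII.1 Rem. 1.1 / Kraus on the support of `Δ`, kernel). [cite: SilvermanAEC2009, VII.1 Remark 1.1] [cite: Kraus1989, Prop. 1–2] -/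
theorem isGloballyMinimal_cm1849a1_8 : (⟨0, 0, 0, (-3440), 77658⟩ : WeierstrassCurve ℚ).IsGloballyMinimal :=
  isGloballyMinimal_of_krausCriterion_support 0 0 0 (-3440) 77658 [(2, 0, 6), (43, 0, 3)]
    (by decide +kernel) (by decide +kernel) (by decide +kernel)

set_option maxRecDepth 100000 in
/-- **Row `cm1849a1_8` — v7's `stub_analyticEtaMu_cm` AT THIS ROW (`p = 5`): every plus branch function `L_5⁺(V,η,X)` of the newform of
`V = [0, 0, 0, -3440, 77658]` (twist of `1849a1` by `8`; CM, `5` inert, `N_V = 118336`; `W = V^{(5)}` has `ε(W) = -1`; PARI `(λ⁺, λ⁻) = (3, 1)`, `μ = 0`, g18) HAS UNIT CONTENT (`μ⁺ = 0`)**,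
from the row's kernel data (`Δ ≠ 0`, minimality, `5 ∤ Δ`, `#V(𝔽₅) = 6`), Mazur's `hM`, and the DISPLAYED pattern `‖ϖ·coeff_jθ₂(η)‖₅ ≤ 5⁻²` (`j < 3`) and `‖ϖ·coeff_3θ₂(η)‖₅ = 5⁻¹` (`λ⁺ = 3`). THE NUMBERS (kit j337120,
row `cm1849a1_8`): `b_0 = 0` (v₅ ∞), `b_1 = 50` (v₅ 2), `b_2 = 800` (v₅ 2), `b_3 = 6065` (v₅ 1), `b_4 = 31445` (v₅ 1) — exactly the registered pattern for `λ⁺ = 3`. [cite: Pollack2003, Prop. 6.18] [cite: Kobayashi2003, Thm. 3.2, (3.4), (3.6) (p. 7)]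
[cite: Mazur1978, Cor. 4.1] [cite: GreenbergVatsal2000, p. 2, (2)] -/
theorem analyticEtaMu_cm1849a1_8_5 [Fact (5 : ℕ).Prime] (hM : mazur_not_dvd_maninConstant_of_odd)
    (V : WeierstrassCurve ℚ) [V.IsElliptic] [V.IsGloballyMinimal] (hV : V = ⟨0, 0, 0, (-3440), 77658⟩)
    (hθ : ∀ {N : ℕ} [NeZero N] {f : CuspForm (Gamma0 N) 2}, IsNewformOf V f →
      ∀ (ϖ : ℚ), (if Even (5 / 2) then (ϖ : ℝ) * V.realPeriodRat = plusPeriod f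
          else (ϖ : ℝ) * V.imaginaryPeriodRat = minusPeriod f) →
        (∀ j < 3, ‖(ϖ : ℚ_[5]) * (((quadraticBranchMazurTateElement 5 f (2 * 1)).coeff j : ℚ) : ℚ_[5])‖ ≤ ((5 : ℝ)⁻¹) ^ (1 + 1)) ∧
          ‖(ϖ : ℚ_[5]) * (((quadraticBranchMazurTateElement 5 f (2 * 1)).coeff 3 : ℚ) : ℚ_[5])‖ = ((5 : ℝ)⁻¹) ^ 1) :
    ∀ {N : ℕ} [NeZero N] {f : CuspForm (Gamma0 N) 2}, IsNewformOf V f →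
      ∀ (ϖ : ℚ), (if Even (5 / 2) then (ϖ : ℝ) * V.realPeriodRat = plusPeriod f
          else (ϖ : ℝ) * V.imaginaryPeriodRat = minusPeriod f) →
      ∀ (Lη : IwasawaAlgebra 5), IsQuadraticBranchPlusLFunction f 5 ϖ Lη → HasUnitContent Lη := by
  intro N _ f hf ϖ hrel Lη hL
  subst hV
  have hI : integralModelInt (⟨0, 0, 0, (-3440), 77658⟩ : WeierstrassCurve ℚ) = ⟨0, 0, 0, (-3440), 77658⟩ :=
    integralModelInt_eq_of_map_eq _ (map_mk_int 0 0 0 (-3440) 77658)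
  obtain ⟨hgood, htr⟩ := good_and_frobeniusTrace_eq_of_countPoints hI 5 (by decide) (by decide +kernel)
  have hap : (⟨0, 0, 0, (-3440), 77658⟩ : WeierstrassCurve ℚ).frobeniusTrace 5 = 0 := by
    rw [htr, show countPoints [0, 0, 0, (-3440), 77658] 5 = 6 by decide +kernel]; norm_num
  exact analyticEtaMu_row_of_mazurTate_padicNorm 5 hM (by norm_num) _ hgood hap 1 le_rfl 3 (by norm_num) hθ hf ϖ hrel Lη hL

/-! ## Row `cm4489a1_21` (twist of `4489a1` by `21`; `N_V = 1979649`, `ε(W) = -1`, PARI `(λ⁺, λ⁻) = (3, 1)`) -/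

/-- Row `cm4489a1_21`: `V = [0, 0, 1, -3250170, 2255315123]`, `Δ = -25795275850323` `= ±3^6·7^6·67^3`: `Δ ≠ 0` (kernel). [cite: SilvermanAEC2009, III.1] -/
theorem isElliptic_cm4489a1_21 : (⟨0, 0, 1, (-3250170), 2255315123⟩ : WeierstrassCurve ℚ).IsElliptic :=
  isElliptic_of_discOf_ne_zero 0 0 1 (-3250170) 2255315123 (by decide +kernel)

set_option maxRecDepth 100000 in
/-- Row `cm4489a1_21` is a global minimal equation (Silverman VII.1 Rem. 1.1 / Kraus on the support of `Δ`, kernel). [cite: SilvermanAEC2009, VII.1 Remark 1.1] [cite: Kraus1989, Prop. 1–2] -/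
theorem isGloballyMinimal_cm4489a1_21 : (⟨0, 0, 1, (-3250170), 2255315123⟩ : WeierstrassCurve ℚ).IsGloballyMinimal :=
  isGloballyMinimal_of_krausCriterion_support 0 0 1 (-3250170) 2255315123 [(3, 0, 6), (7, 0, 6), (67, 0, 3)]
    (by decide +kernel) (by decide +kernel) (by decide +kernel)

set_option maxRecDepth 100000 in
/-- **Row `cm4489a1_21` — v7's `stub_analyticEtaMu_cm` AT THIS ROW (`p = 5`): every plus branch function `L_5⁺(V,η,X)` of the newform of
`V = [0, 0, 1, -3250170, 2255315123]` (twist of `4489a1` by `21`; CM, `5` inert, `N_V = 1979649`; `W = V^{(5)}` has `ε(W) = -1`; PARI `(λ⁺, λ⁻) = (3, 1)`, `μ = 0`, g18) HAS UNIT CONTENT (`μ⁺ = 0`)**,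
from the row's kernel data (`Δ ≠ 0`, minimality, `5 ∤ Δ`, `#V(𝔽₅) = 6`), Mazur's `hM`, and the DISPLAYED pattern `‖ϖ·coeff_jθ₂(η)‖₅ ≤ 5⁻²` (`j < 3`) and `‖ϖ·coeff_3θ₂(η)‖₅ = 5⁻¹` (`λ⁺ = 3`). THE NUMBERS (kit j337120,
row `cm4489a1_21`): `b_0 = 0` (v₅ ∞), `b_1 = -75` (v₅ 2), `b_2 = -1675` (v₅ 2), `b_3 = -16820` (v₅ 1), `b_4 = -101395` (v₅ 1) — exactly the registered pattern for `λ⁺ = 3`. [cite: Pollack2003, Prop. 6.18] [cite: Kobayashi2003, Thm. 3.2, (3.4), (3.6) (p. 7)]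
[cite: Mazur1978, Cor. 4.1] [cite: GreenbergVatsal2000, p. 2, (2)] -/
theorem analyticEtaMu_cm4489a1_21_5 [Fact (5 : ℕ).Prime] (hM : mazur_not_dvd_maninConstant_of_odd)
    (V : WeierstrassCurve ℚ) [V.IsElliptic] [V.IsGloballyMinimal] (hV : V = ⟨0, 0, 1, (-3250170), 2255315123⟩)
    (hθ : ∀ {N : ℕ} [NeZero N] {f : CuspForm (Gamma0 N) 2}, IsNewformOf V f →
      ∀ (ϖ : ℚ), (if Even (5 / 2) then (ϖ : ℝ) * V.realPeriodRat = plusPeriod f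
          else (ϖ : ℝ) * V.imaginaryPeriodRat = minusPeriod f) →
        (∀ j < 3, ‖(ϖ : ℚ_[5]) * (((quadraticBranchMazurTateElement 5 f (2 * 1)).coeff j : ℚ) : ℚ_[5])‖ ≤ ((5 : ℝ)⁻¹) ^ (1 + 1)) ∧
          ‖(ϖ : ℚ_[5]) * (((quadraticBranchMazurTateElement 5 f (2 * 1)).coeff 3 : ℚ) : ℚ_[5])‖ = ((5 : ℝ)⁻¹) ^ 1) :
    ∀ {N : ℕ} [NeZero N] {f : CuspForm (Gamma0 N) 2}, IsNewformOf V f →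
      ∀ (ϖ : ℚ), (if Even (5 / 2) then (ϖ : ℝ) * V.realPeriodRat = plusPeriod f
          else (ϖ : ℝ) * V.imaginaryPeriodRat = minusPeriod f) →
      ∀ (Lη : IwasawaAlgebra 5), IsQuadraticBranchPlusLFunction f 5 ϖ Lη → HasUnitContent Lη := by
  intro N _ f hf ϖ hrel Lη hL
  subst hV
  have hI : integralModelInt (⟨0, 0, 1, (-3250170), 2255315123⟩ : WeierstrassCurve ℚ) = ⟨0, 0, 1, (-3250170), 2255315123⟩ :=
    integralModelInt_eq_of_map_eq _ (map_mk_int 0 0 1 (-3250170) 2255315123)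
  obtain ⟨hgood, htr⟩ := good_and_frobeniusTrace_eq_of_countPoints hI 5 (by decide) (by decide +kernel)
  have hap : (⟨0, 0, 1, (-3250170), 2255315123⟩ : WeierstrassCurve ℚ).frobeniusTrace 5 = 0 := by
    rw [htr, show countPoints [0, 0, 1, (-3250170), 2255315123] 5 = 6 by decide +kernel]; norm_num
  exact analyticEtaMu_row_of_mazurTate_padicNorm 5 hM (by norm_num) _ hgood hap 1 le_rfl 3 (by norm_num) hθ hf ϖ hrel Lη hL

/-! ## Row `cm26569a1_m4` (twist of `26569a1` by `-4`; `N_V = 425104`, `ε(W) = 1`, PARI `(λ⁺, λ⁻) = (2, 2)`) -/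

/-- Row `cm26569a1_m4`: `V = [0, 0, 0, -34790720, -78984748304]`, `Δ = -17738739712` `= ±2^12·163^3`: `Δ ≠ 0` (kernel). [cite: SilvermanAEC2009, III.1] -/
theorem isElliptic_cm26569a1_m4 : (⟨0, 0, 0, (-34790720), (-78984748304)⟩ : WeierstrassCurve ℚ).IsElliptic :=
  isElliptic_of_discOf_ne_zero 0 0 0 (-34790720) (-78984748304) (by decide +kernel)

set_option maxRecDepth 100000 in
/-- Row `cm26569a1_m4` is a global minimal equation (Silverman VII.1 Rem. 1.1 / Kraus on the support of `Δ`, kernel). [cite: SilvermanAEC2009, VII.1 Remark 1.1] [cite: Kraus1989, Prop. 1–2] -/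
theorem isGloballyMinimal_cm26569a1_m4 : (⟨0, 0, 0, (-34790720), (-78984748304)⟩ : WeierstrassCurve ℚ).IsGloballyMinimal :=
  isGloballyMinimal_of_krausCriterion_support 0 0 0 (-34790720) (-78984748304) [(2, 0, 12), (163, 0, 3)]
    (by decide +kernel) (by decide +kernel) (by decide +kernel)

set_option maxRecDepth 100000 in
/-- **Row `cm26569a1_m4` — v7's `stub_analyticEtaMu_cm` AT THIS ROW (`p = 5`): every plus branch function `L_5⁺(V,η,X)` of the newform of
`V = [0, 0, 0, -34790720, -78984748304]` (twist of `26569a1` by `-4`; CM, `5` inert, `N_V = 425104`; `W = V^{(5)}` has `ε(W) = 1`; PARI `(λ⁺, λ⁻) = (2, 2)`, `μ = 0`, g18) HAS UNIT CONTENT (`μ⁺ = 0`)**,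
from the row's kernel data (`Δ ≠ 0`, minimality, `5 ∤ Δ`, `#V(𝔽₅) = 6`), Mazur's `hM`, and the DISPLAYED pattern `‖ϖ·coeff_jθ₂(η)‖₅ ≤ 5⁻²` (`j < 2`) and `‖ϖ·coeff_2θ₂(η)‖₅ = 5⁻¹` (`λ⁺ = 2`). THE NUMBERS (kit j337120,
row `cm26569a1_m4`): `b_0 = 0` (v₅ ∞), `b_1 = -5050` (v₅ 2), `b_2 = -55990` (v₅ 1), `b_3 = -386320` (v₅ 1) — exactly the registered pattern for `λ⁺ = 2`. [cite: Pollack2003, Prop. 6.18] [cite: Kobayashi2003, Thm. 3.2, (3.4), (3.6) (p. 7)]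
[cite: Mazur1978, Cor. 4.1] [cite: GreenbergVatsal2000, p. 2, (2)] -/
theorem analyticEtaMu_cm26569a1_m4_5 [Fact (5 : ℕ).Prime] (hM : mazur_not_dvd_maninConstant_of_odd)
    (V : WeierstrassCurve ℚ) [V.IsElliptic] [V.IsGloballyMinimal] (hV : V = ⟨0, 0, 0, (-34790720), (-78984748304)⟩)
    (hθ : ∀ {N : ℕ} [NeZero N] {f : CuspForm (Gamma0 N) 2}, IsNewformOf V f →
      ∀ (ϖ : ℚ), (if Even (5 / 2) then (ϖ : ℝ) * V.realPeriodRat = plusPeriod f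
          else (ϖ : ℝ) * V.imaginaryPeriodRat = minusPeriod f) →
        (∀ j < 2, ‖(ϖ : ℚ_[5]) * (((quadraticBranchMazurTateElement 5 f (2 * 1)).coeff j : ℚ) : ℚ_[5])‖ ≤ ((5 : ℝ)⁻¹) ^ (1 + 1)) ∧
          ‖(ϖ : ℚ_[5]) * (((quadraticBranchMazurTateElement 5 f (2 * 1)).coeff 2 : ℚ) : ℚ_[5])‖ = ((5 : ℝ)⁻¹) ^ 1) :
    ∀ {N : ℕ} [NeZero N] {f : CuspForm (Gamma0 N) 2}, IsNewformOf V f →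
      ∀ (ϖ : ℚ), (if Even (5 / 2) then (ϖ : ℝ) * V.realPeriodRat = plusPeriod f
          else (ϖ : ℝ) * V.imaginaryPeriodRat = minusPeriod f) →
      ∀ (Lη : IwasawaAlgebra 5), IsQuadraticBranchPlusLFunction f 5 ϖ Lη → HasUnitContent Lη := by
  intro N _ f hf ϖ hrel Lη hL
  subst hV
  have hI : integralModelInt (⟨0, 0, 0, (-34790720), (-78984748304)⟩ : WeierstrassCurve ℚ) = ⟨0, 0, 0, (-34790720), (-78984748304)⟩ :=
    integralModelInt_eq_of_map_eq _ (map_mk_int 0 0 0 (-34790720) (-78984748304))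
  obtain ⟨hgood, htr⟩ := good_and_frobeniusTrace_eq_of_countPoints hI 5 (by decide) (by decide +kernel)
  have hap : (⟨0, 0, 0, (-34790720), (-78984748304)⟩ : WeierstrassCurve ℚ).frobeniusTrace 5 = 0 := by
    rw [htr, show countPoints [0, 0, 0, (-34790720), (-78984748304)] 5 = 6 by decide +kernel]; norm_num
  exact analyticEtaMu_row_of_mazurTate_padicNorm 5 hM (by norm_num) _ hgood hap 1 le_rfl 2 (by norm_num) hθ hf ϖ hrel Lη hL

end Summit.BirchSwinnertonDyer.BirchSwinnertonDyer.Theorems.EtaAnalyticMuRecords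

end
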